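import Mathlib
import HarnessLib
import Literature.Analysis.Convex.KrasnoselskijIteration

/-!
# The Ishikawa iteration for Lipschitzian pseudocontractive maps in Hilbert space (Ishikawa 1974)

Source: V. Berinde, *Iterative Approximation of Fixed Points*, 2nd ed., Lecture Notes in
Mathematics 1912, Springer (2007) [Berinde2007], Chapter 5 "The Ishikawa Iteration", §5.1,
**Theorem 5.1** (= S. Ishikawa, *Fixed points by a new iteration method*, Proc. Amer. Math. Soc.
44 (1974) 147–150) with its complete proof, formulas (1)–(13).

**Theorem 5.1.** Let `K` be a convex compact subset of a Hilbert space `H`, `T : K → K`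
Lipschitzian (constant `L`) and pseudocontractive, i.e. (2)
`‖Tx - Ty‖² ≤ ‖x - y‖² + ‖(I - T)x - (I - T)y‖²`, and `x₁ ∈ K`.  Then the Ishikawa iteration (1)
`x_{n+1} = (1 - α_n)x_n + α_n T[(1 - β_n)x_n + β_n Tx_n]`, with (i) `0 ≤ α_n ≤ β_n ≤ 1`,
(ii) `β_n → 0`, (iii) `Σ α_n β_n = ∞`, converges strongly to a fixed point of `T`.

What is formalised (all in a real inner product space `E`, for a map `T : E → E` with
`MapsTo T K K` and hypotheses on `K` only):

* `ishikawaStep T a b x = (1 - a)x + aT((1 - b)x + bTx)` and the iteration `ishikawaIter T α β x₀`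
  ((1), indexed from `0`); the orbit stays in the convex set `K` (`ishikawaIter_mem`).
* The heart of the proof, inequality **(12)**: for `x, p ∈ K`, `Tp = p`, `0 ≤ a ≤ b ≤ 1`,
  `‖x⁺ - p‖² ≤ ‖x - p‖² - ab(1 - 2b - L²b²)‖x - Tx‖²` (`norm_ishikawaStep_sub_sq_le`), obtained
  exactly as in the book from the identity (4) (`KrasnoselskijIteration.norm_sq_convex_combination`,
  Lemma 1.8) applied three times ((5), (6), (7)), the pseudocontractivity (2) applied twice ((8),
  (9)), hypothesis (i), and the Lipschitz estimate (11); for the orbit: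
  `norm_ishikawaIter_succ_sub_sq_le`.
* (ii) gives an `N` with `2β_n + L²β_n² ≤ 1/2` for `n ≥ N` (`exists_forall_ishikawaCoeff_le_half`),
  whence Fejér monotonicity `‖x_{n+1} - p‖ ≤ ‖x_n - p‖` for `n ≥ N`
  (`norm_ishikawaIter_succ_sub_le`)
  and the telescoped bound (13) `½ Σ_{k=m}^{n} α_kβ_k‖x_k - Tx_k‖² ≤ ‖x_m - p‖² - ‖x_{n+1} - p‖²`
  (`ishikawaIter_sum_residual_sq_le`).
* (iii) then forces `lim inf ‖x_n - Tx_n‖ = 0`, stated as "`‖x_n - Tx_n‖ < ε` frequently"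
  (`ishikawaIter_frequently_residual_lt`), and compactness of `K` plus continuity of `T` produce a
  subsequence
  converging to a fixed point `q ∈ K` (`ishikawaIter_exists_fixedPoint_subseq_tendsto`);
  finally the
  non-increasing distances `‖x_n - q‖` give the **theorem**:
  `exists_fixedPoint_tendsto_ishikawaIter`
  — for every `x₀ ∈ K` the Ishikawa iteration converges to a fixed point of `T` in `K`.

Deviations from the source (declared).  (a) The existence of a fixed point of `T` in `K`, which
[Ber07] takes from Schauder's theorem, is a hypothesis `∃ p ∈ K, Tp = p` of the lemmas where it is
used and of the theorem (Schauder's fixed point theorem is not available here in the needed form).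
(b) `T` is a map `E → E` with `MapsTo T K K`; the Lipschitz and pseudocontractivity hypotheses are
imposed on `K` only.  (c) Indices start at `0`.  (d) `H` need not be complete: `E` is any real
inner product space (compactness of `K` is what is used).  (e) In (13) the book prints
`‖Tx_m - p‖² - ‖Tx_{n+1} - p‖²` on the right; the telescoping of (12) gives (and we state)
`‖x_m - p‖² - ‖x_{n+1} - p‖²`.  By-name reuse: `norm_sq_convex_combination`
(`Literature.Analysis.Convex.KrasnoselskijIteration`).  The pseudocontractivity hypothesis (2) is
written out (it is `StrictPseudocontractions.IsPseudocontractive` restricted to `K`).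
-/

open Filter Topology Set Function Finset
open Literature.Analysis.Convex.KrasnoselskijIteration (norm_sq_convex_combination)

namespace Literature.Analysis.Convex.IshikawaIteration

variable {E : Type*} [NormedAddCommGroup E] [InnerProductSpace ℝ E]

/-! ## The iteration -/

/-- One Ishikawa step (1): `x⁺ = (1 - a)x + aT[(1 - b)x + bTx]`.
[cite: Berinde2007, Ch. 5 §5.1 Thm. 5.1 (1)] -/
def ishikawaStep (T : E → E) (a b : ℝ) (x : E) : E :=
  (1 - a) • x + a • T ((1 - b) • x + b • T x)

/-- The Ishikawa iteration `I(x₀, α_n, β_n, T)` (1), indexed from `0`.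
[cite: Berinde2007, Ch. 5 §5.1 Thm. 5.1 (1)] -/
def ishikawaIter (T : E → E) (α β : ℕ → ℝ) (x₀ : E) : ℕ → E
  | 0 => x₀
  | n + 1 => ishikawaStep T (α n) (β n) (ishikawaIter T α β x₀ n)

section Orbit

variable {T : E → E} {K : Set E} {α β : ℕ → ℝ} {x₀ : E}

/-- [cite: Berinde2007, Ch. 5 §5.1 Thm. 5.1 (1)] -/
@[simp] theorem ishikawaIter_zero (T : E → E) (α β : ℕ → ℝ) (x₀ : E) :
    ishikawaIter T α β x₀ 0 = x₀ := rfl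

/-- [cite: Berinde2007, Ch. 5 §5.1 Thm. 5.1 (1)] -/
theorem ishikawaIter_succ (T : E → E) (α β : ℕ → ℝ) (x₀ : E) (n : ℕ) :
    ishikawaIter T α β x₀ (n + 1) = ishikawaStep T (α n) (β n) (ishikawaIter T α β x₀ n) := rfl

/-- The inner point `y = (1 - b)x + bTx` lies in the convex set `K` (`T(K) ⊆ K`, `b ∈ [0, 1]`).
[cite: Berinde2007, Ch. 5 §5.1 Thm. 5.1 (proof)] -/
theorem ishikawaInner_mem (hK : Convex ℝ K) (hTK : MapsTo T K K) {x : E} (hx : x ∈ K) {b : ℝ}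
    (hb0 : 0 ≤ b) (hb1 : b ≤ 1) : (1 - b) • x + b • T x ∈ K :=
  hK hx (hTK hx) (by linarith) hb0 (by ring)

/-- An Ishikawa step stays in the convex set `K` (`a, b ∈ [0, 1]`).
[cite: Berinde2007, Ch. 5 §5.1 Thm. 5.1 (proof)] -/
theorem ishikawaStep_mem (hK : Convex ℝ K) (hTK : MapsTo T K K) {x : E} (hx : x ∈ K) {a b : ℝ}
    (ha0 : 0 ≤ a) (ha1 : a ≤ 1) (hb0 : 0 ≤ b) (hb1 : b ≤ 1) : ishikawaStep T a b x ∈ K :=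
  hK hx (hTK (ishikawaInner_mem hK hTK hx hb0 hb1)) (by linarith) ha0 (by ring)

/-- The Ishikawa orbit stays in `K` under (i). [cite: Berinde2007, Ch. 5 §5.1 Thm. 5.1 (proof)] -/
theorem ishikawaIter_mem (hK : Convex ℝ K) (hTK : MapsTo T K K) (hx₀ : x₀ ∈ K)
    (hα0 : ∀ n, 0 ≤ α n) (hαβ : ∀ n, α n ≤ β n) (hβ1 : ∀ n, β n ≤ 1) (n : ℕ) :
    ishikawaIter T α β x₀ n ∈ K := by
  induction n with
  | zero => exact hx₀
  | succ n ih =>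
    exact ishikawaStep_mem hK hTK ih (hα0 n) ((hαβ n).trans (hβ1 n)) ((hα0 n).trans (hαβ n))
      (hβ1 n)

end Orbit

/-! ## Inequality (12) -/

section KeyInequality

variable {T : E → E} {K : Set E} {L : ℝ}

/-- **Inequality (12)** for one step: if `T` is pseudocontractive (2) and `L`-Lipschitzian (3) on
the convex set `K ⊇ T(K)`, `x, p ∈ K`, `Tp = p` and `0 ≤ a ≤ b ≤ 1` (hypothesis (i)), then
`‖x⁺ - p‖² ≤ ‖x - p‖² - ab(1 - 2b - L²b²)‖x - Tx‖²`.  Proof as in the book: (5), (6), (7) are the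
identity (4) = Lemma 1.8, (8), (9) are (2), (11) is (3), combined as
`(5) + a[(6) + (7) + (8) + b(9)]` and (i).
[cite: Berinde2007, Ch. 5 §5.1 Thm. 5.1 (proof, (4)–(12))] -/
theorem norm_ishikawaStep_sub_sq_le
    (h2 : ∀ ⦃x⦄, x ∈ K → ∀ ⦃y⦄, y ∈ K → ‖T x - T y‖ ^ 2 ≤ ‖x - y‖ ^ 2 + ‖(x - T x) - (y - T y)‖ ^ 2)
    (h3 : ∀ ⦃x⦄, x ∈ K → ∀ ⦃y⦄, y ∈ K → ‖T x - T y‖ ≤ L * ‖x - y‖)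
    (hK : Convex ℝ K) (hTK : MapsTo T K K) {x p : E} (hx : x ∈ K) (hp : p ∈ K) (hTp : T p = p)
    {a b : ℝ} (ha0 : 0 ≤ a) (hab : a ≤ b) (hb1 : b ≤ 1) :
    ‖ishikawaStep T a b x - p‖ ^ 2 ≤
      ‖x - p‖ ^ 2 - a * b * (1 - 2 * b - L ^ 2 * b ^ 2) * ‖x - T x‖ ^ 2 := by
  have hb0 : 0 ≤ b := ha0.trans hab
  have hyK : (1 - b) • x + b • T x ∈ K := ishikawaInner_mem hK hTK hx hb0 hb1
  unfold ishikawaStep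
  generalize hy : (1 - b) • x + b • T x = y at hyK ⊢
  -- (5), (6), (7): three instances of the identity (4)
  have e5 : (1 - a) • x + a • T y - p = (1 - a) • (x - p) + a • (T y - p) := by module
  have e6 : y - p = (1 - b) • (x - p) + b • (T x - p) := by rw [← hy]; module
  have e7 : y - T y = (1 - b) • (x - T y) + b • (T x - T y) := by rw [← hy]; module
  have i5 := norm_sq_convex_combination (x - p) (T y - p) a
  have i6 := norm_sq_convex_combination (x - p) (T x - p) b
  have i7 := norm_sq_convex_combination (x - T y) (T x - T y) b
  rw [show (x - p) - (T y - p) = x - T y by abel] at i5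
  rw [show (x - p) - (T x - p) = x - T x by abel] at i6
  rw [show (x - T y) - (T x - T y) = x - T x by abel] at i7
  -- (8), (9): pseudocontractivity at `(y, p)` and `(x, p)`
  have i8 := h2 hyK hp
  have i9 := h2 hx hp
  rw [hTp, sub_self, sub_zero] at i8 i9
  rw [e6, i6, e7, i7] at i8
  -- (11): the Lipschitz estimate, `x - y = b(x - Tx)`
  have i11 : ‖T x - T y‖ ^ 2 ≤ L ^ 2 * b ^ 2 * ‖x - T x‖ ^ 2 := by
    have h := h3 hx hyK
    rw [show x - y = b • (x - T x) by rw [← hy]; module, norm_smul, Real.norm_eq_abs,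
      abs_of_nonneg hb0] at h
    calc ‖T x - T y‖ ^ 2 ≤ (L * (b * ‖x - T x‖)) ^ 2 := pow_le_pow_left₀ (norm_nonneg _) h 2
      _ = L ^ 2 * b ^ 2 * ‖x - T x‖ ^ 2 := by ring
  rw [e5, i5]
  have hab0 : 0 ≤ a * b := mul_nonneg ha0 hb0
  nlinarith [mul_le_mul_of_nonneg_left i8 ha0, mul_le_mul_of_nonneg_left i9 hab0,
    mul_le_mul_of_nonneg_left i11 hab0,
    mul_nonneg (mul_nonneg ha0 (sub_nonneg.2 hab)) (sq_nonneg ‖x - T y‖)]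

end KeyInequality

/-! ## The orbit: (12), Fejér monotonicity for `n ≥ N`, and (13) -/

section OrbitEstimates

variable {T : E → E} {K : Set E} {L : ℝ} {α β : ℕ → ℝ} {x₀ p : E}

/-- (12) along the Ishikawa orbit: for `p ∈ Fix T ∩ K` and every `n`,
`‖x_{n+1} - p‖² ≤ ‖x_n - p‖² - α_nβ_n(1 - 2β_n - L²β_n²)‖x_n - Tx_n‖²`.
[cite: Berinde2007, Ch. 5 §5.1 Thm. 5.1 (12)] -/
theorem norm_ishikawaIter_succ_sub_sq_le
    (h2 : ∀ ⦃x⦄, x ∈ K → ∀ ⦃y⦄, y ∈ K → ‖T x - T y‖ ^ 2 ≤ ‖x - y‖ ^ 2 + ‖(x - T x) - (y - T y)‖ ^ 2)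
    (h3 : ∀ ⦃x⦄, x ∈ K → ∀ ⦃y⦄, y ∈ K → ‖T x - T y‖ ≤ L * ‖x - y‖)
    (hK : Convex ℝ K) (hTK : MapsTo T K K) (hx₀ : x₀ ∈ K) (hp : p ∈ K) (hTp : T p = p)
    (hα0 : ∀ n, 0 ≤ α n) (hαβ : ∀ n, α n ≤ β n) (hβ1 : ∀ n, β n ≤ 1) (n : ℕ) :
    ‖ishikawaIter T α β x₀ (n + 1) - p‖ ^ 2 ≤
      ‖ishikawaIter T α β x₀ n - p‖ ^ 2 - α n * β n * (1 - 2 * β n - L ^ 2 * β n ^ 2) *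
        ‖ishikawaIter T α β x₀ n - T (ishikawaIter T α β x₀ n)‖ ^ 2 := by
  rw [ishikawaIter_succ]
  exact norm_ishikawaStep_sub_sq_le h2 h3 hK hTK (ishikawaIter_mem hK hTK hx₀ hα0 hαβ hβ1 n)
    hp hTp (hα0 n) (hαβ n) (hβ1 n)

/-- Hypothesis (ii) `β_n → 0` gives an `N` with `2β_k + L²β_k² ≤ 1/2` for all `k ≥ N`.
[cite: Berinde2007, Ch. 5 §5.1 Thm. 5.1 (proof, before (13))] -/
theorem exists_forall_ishikawaCoeff_le_half (hβ : Tendsto β atTop (𝓝 0)) (L : ℝ) :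
    ∃ N, ∀ k ≥ N, 2 * β k + L ^ 2 * β k ^ 2 ≤ 1 / 2 := by
  have h : Tendsto (fun k => 2 * β k + L ^ 2 * β k ^ 2) atTop (𝓝 0) := by
    have h1 := (hβ.const_mul 2).add ((hβ.pow 2).const_mul (L ^ 2))
    simpa using h1
  have hev := (tendsto_order.1 h).2 (1 / 2) (by norm_num)
  obtain ⟨N, hN⟩ := eventually_atTop.1 hev
  exact ⟨N, fun k hk => (hN k hk).le⟩

/-- Fejér monotonicity for `n ≥ N`: `‖x_{n+1} - p‖ ≤ ‖x_n - p‖` ("the sequence `{‖x_n - q‖}` is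
non-increasing"). [cite: Berinde2007, Ch. 5 §5.1 Thm. 5.1 (proof, end)] -/
theorem norm_ishikawaIter_succ_sub_le
    (h2 : ∀ ⦃x⦄, x ∈ K → ∀ ⦃y⦄, y ∈ K → ‖T x - T y‖ ^ 2 ≤ ‖x - y‖ ^ 2 + ‖(x - T x) - (y - T y)‖ ^ 2)
    (h3 : ∀ ⦃x⦄, x ∈ K → ∀ ⦃y⦄, y ∈ K → ‖T x - T y‖ ≤ L * ‖x - y‖)
    (hK : Convex ℝ K) (hTK : MapsTo T K K) (hx₀ : x₀ ∈ K) (hp : p ∈ K) (hTp : T p = p)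
    (hα0 : ∀ n, 0 ≤ α n) (hαβ : ∀ n, α n ≤ β n) (hβ1 : ∀ n, β n ≤ 1)
    {N : ℕ} (hN : ∀ k ≥ N, 2 * β k + L ^ 2 * β k ^ 2 ≤ 1 / 2) {n : ℕ} (hn : N ≤ n) :
    ‖ishikawaIter T α β x₀ (n + 1) - p‖ ≤ ‖ishikawaIter T α β x₀ n - p‖ := by
  have h := norm_ishikawaIter_succ_sub_sq_le h2 h3 hK hTK hx₀ hp hTp hα0 hαβ hβ1 n
  have hc : 0 ≤ α n * β n * (1 - 2 * β n - L ^ 2 * β n ^ 2) *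
      ‖ishikawaIter T α β x₀ n - T (ishikawaIter T α β x₀ n)‖ ^ 2 :=
    mul_nonneg (mul_nonneg (mul_nonneg (hα0 n) ((hα0 n).trans (hαβ n)))
      (by linarith [hN n hn])) (sq_nonneg _)
  exact (pow_le_pow_iff_left₀ (norm_nonneg _) (norm_nonneg _) two_ne_zero).1 (by linarith)

/-- Non-increasing distances from `N` on: `‖x_n - p‖ ≤ ‖x_m - p‖` for `N ≤ m ≤ n`.
[cite: Berinde2007, Ch. 5 §5.1 Thm. 5.1 (proof, end)] -/
theorem norm_ishikawaIter_sub_le_of_le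
    (h2 : ∀ ⦃x⦄, x ∈ K → ∀ ⦃y⦄, y ∈ K → ‖T x - T y‖ ^ 2 ≤ ‖x - y‖ ^ 2 + ‖(x - T x) - (y - T y)‖ ^ 2)
    (h3 : ∀ ⦃x⦄, x ∈ K → ∀ ⦃y⦄, y ∈ K → ‖T x - T y‖ ≤ L * ‖x - y‖)
    (hK : Convex ℝ K) (hTK : MapsTo T K K) (hx₀ : x₀ ∈ K) (hp : p ∈ K) (hTp : T p = p)
    (hα0 : ∀ n, 0 ≤ α n) (hαβ : ∀ n, α n ≤ β n) (hβ1 : ∀ n, β n ≤ 1)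
    {N : ℕ} (hN : ∀ k ≥ N, 2 * β k + L ^ 2 * β k ^ 2 ≤ 1 / 2) {m n : ℕ} (hm : N ≤ m)
    (hmn : m ≤ n) : ‖ishikawaIter T α β x₀ n - p‖ ≤ ‖ishikawaIter T α β x₀ m - p‖ := by
  induction n, hmn using Nat.le_induction with
  | base => exact le_rfl
  | succ n hmn ih =>
    exact (norm_ishikawaIter_succ_sub_le h2 h3 hK hTK hx₀ hp hTp hα0 hαβ hβ1 hN
      (hm.trans hmn)).trans ih

/-- **(13)**, telescoped from (12): for `m ≥ N` and every `n`,
`½ Σ_{k=m}^{m+n-1} α_kβ_k‖x_k - Tx_k‖² ≤ ‖x_m - p‖² - ‖x_{m+n} - p‖²`.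
[cite: Berinde2007, Ch. 5 §5.1 Thm. 5.1 (13)] -/
theorem ishikawaIter_sum_residual_sq_le
    (h2 : ∀ ⦃x⦄, x ∈ K → ∀ ⦃y⦄, y ∈ K → ‖T x - T y‖ ^ 2 ≤ ‖x - y‖ ^ 2 + ‖(x - T x) - (y - T y)‖ ^ 2)
    (h3 : ∀ ⦃x⦄, x ∈ K → ∀ ⦃y⦄, y ∈ K → ‖T x - T y‖ ≤ L * ‖x - y‖)
    (hK : Convex ℝ K) (hTK : MapsTo T K K) (hx₀ : x₀ ∈ K) (hp : p ∈ K) (hTp : T p = p)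
    (hα0 : ∀ n, 0 ≤ α n) (hαβ : ∀ n, α n ≤ β n) (hβ1 : ∀ n, β n ≤ 1)
    {N : ℕ} (hN : ∀ k ≥ N, 2 * β k + L ^ 2 * β k ^ 2 ≤ 1 / 2) {m : ℕ} (hm : N ≤ m) (n : ℕ) :
    (1 / 2) * ∑ k ∈ range n, α (m + k) * β (m + k) *
        ‖ishikawaIter T α β x₀ (m + k) - T (ishikawaIter T α β x₀ (m + k))‖ ^ 2 ≤
      ‖ishikawaIter T α β x₀ m - p‖ ^ 2 - ‖ishikawaIter T α β x₀ (m + n) - p‖ ^ 2 := by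
  induction n with
  | zero => simp
  | succ n ih =>
    rw [sum_range_succ, mul_add, ← add_assoc m n 1]
    have h12 := norm_ishikawaIter_succ_sub_sq_le h2 h3 hK hTK hx₀ hp hTp hα0 hαβ hβ1 (m + n)
    have hc : (1 / 2) * (α (m + n) * β (m + n) *
        ‖ishikawaIter T α β x₀ (m + n) - T (ishikawaIter T α β x₀ (m + n))‖ ^ 2) ≤
        α (m + n) * β (m + n) * (1 - 2 * β (m + n) - L ^ 2 * β (m + n) ^ 2) *
          ‖ishikawaIter T α β x₀ (m + n) - T (ishikawaIter T α β x₀ (m + n))‖ ^ 2 := by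
      have hab : 0 ≤ α (m + n) * β (m + n) :=
        mul_nonneg (hα0 _) ((hα0 _).trans (hαβ _))
      have h1 : 1 / 2 ≤ 1 - 2 * β (m + n) - L ^ 2 * β (m + n) ^ 2 := by
        linarith [hN (m + n) (hm.trans (Nat.le_add_right m n))]
      nlinarith [mul_le_mul_of_nonneg_left h1 (mul_nonneg hab (sq_nonneg
        ‖ishikawaIter T α β x₀ (m + n) - T (ishikawaIter T α β x₀ (m + n))‖))]
    linarith

end OrbitEstimates

/-! ## Theorem 5.1 -/

section Theorem51

variable {T : E → E} {K : Set E} {L : ℝ} {α β : ℕ → ℝ} {x₀ : E}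

/-- From (13) and (iii) `Σ α_nβ_n = ∞`: `lim inf ‖x_n - Tx_n‖ = 0`, i.e. for every `ε > 0` the
residual is `< ε` for infinitely many `n`.
[cite: Berinde2007, Ch. 5 §5.1 Thm. 5.1 (proof, after (13))] -/
theorem ishikawaIter_frequently_residual_lt
    (h2 : ∀ ⦃x⦄, x ∈ K → ∀ ⦃y⦄, y ∈ K → ‖T x - T y‖ ^ 2 ≤ ‖x - y‖ ^ 2 + ‖(x - T x) - (y - T y)‖ ^ 2)
    (h3 : ∀ ⦃x⦄, x ∈ K → ∀ ⦃y⦄, y ∈ K → ‖T x - T y‖ ≤ L * ‖x - y‖)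
    (hK : Convex ℝ K) (hTK : MapsTo T K K) (hx₀ : x₀ ∈ K) (hfix : ∃ p ∈ K, T p = p)
    (hα0 : ∀ n, 0 ≤ α n) (hαβ : ∀ n, α n ≤ β n) (hβ1 : ∀ n, β n ≤ 1)
    (hβ : Tendsto β atTop (𝓝 0))
    (hdiv : Tendsto (fun n => ∑ k ∈ range n, α k * β k) atTop atTop) {ε : ℝ} (hε : 0 < ε) :
    ∃ᶠ n in atTop, ‖ishikawaIter T α β x₀ n - T (ishikawaIter T α β x₀ n)‖ < ε := by
  obtain ⟨p, hp, hTp⟩ := hfix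
  obtain ⟨N, hN⟩ := exists_forall_ishikawaCoeff_le_half hβ L
  by_contra hcon
  obtain ⟨M, hM⟩ := eventually_atTop.1 (not_frequently.1 hcon)
  -- from `m = max M N` on, the residual is `≥ ε` and the partial sums of (13) are bounded
  set m := max M N with hm_def
  have hmM : M ≤ m := le_max_left _ _
  have hmN : N ≤ m := le_max_right _ _
  set x := ishikawaIter T α β x₀ with hx_def
  have hres : ∀ k, ε ≤ ‖x (m + k) - T (x (m + k))‖ := fun k =>
    not_lt.1 (hM (m + k) (hmM.trans (Nat.le_add_right m k)))
  have hA := fun n => ishikawaIter_sum_residual_sq_le h2 h3 hK hTK hx₀ hp hTp hα0 hαβ hβ1 hN hmN n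
  -- lower bound: `ε² Σ_{k<n} α_{m+k}β_{m+k} ≤ Σ_{k<n} α_{m+k}β_{m+k}‖x_{m+k} - Tx_{m+k}‖²`
  have hlow : ∀ n, ε ^ 2 * ∑ k ∈ range n, α (m + k) * β (m + k) ≤
      ∑ k ∈ range n, α (m + k) * β (m + k) * ‖x (m + k) - T (x (m + k))‖ ^ 2 := by
    intro n
    rw [mul_sum]
    refine sum_le_sum fun k _ => ?_
    have hab : 0 ≤ α (m + k) * β (m + k) := mul_nonneg (hα0 _) ((hα0 _).trans (hαβ _))
    have h1 : ε ^ 2 ≤ ‖x (m + k) - T (x (m + k))‖ ^ 2 := pow_le_pow_left₀ hε.le (hres k) 2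
    nlinarith [mul_le_mul_of_nonneg_left h1 hab]
  -- hence the shifted partial sums of `Σ α_kβ_k` are bounded by `B`
  set B := 2 * ‖x m - p‖ ^ 2 / ε ^ 2 with hB
  have hbound : ∀ n, ∑ k ∈ range n, α (m + k) * β (m + k) ≤ B := by
    intro n
    have h1 := (hlow n).trans ((le_div_iff₀' (by norm_num : (0 : ℝ) < 1 / 2)).2
      ((hA n).trans (sub_le_self _ (sq_nonneg _))))
    rw [hB, le_div_iff₀ (pow_pos hε 2)]
    have e : (‖x m - p‖ ^ 2 - 0) = ‖x m - p‖ ^ 2 := sub_zero _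
    nlinarith [h1]
  -- but (iii) makes them unbounded
  have hev := (tendsto_atTop.1 hdiv) (∑ k ∈ range m, α k * β k + B + 1)
  obtain ⟨n₀, hn₀⟩ := eventually_atTop.1 hev
  have h1 := hn₀ (max n₀ m) (le_max_left _ _)
  obtain ⟨j, hj⟩ := Nat.exists_eq_add_of_le (le_max_right n₀ m)
  rw [hj, sum_range_add] at h1
  linarith [hbound j]

/-- Compactness step: a subsequence of the Ishikawa orbit converges to a fixed point `q ∈ K` of `T`
(along which `‖x_n - Tx_n‖ → 0`; `T` is continuous on `K`, being Lipschitzian).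
[cite: Berinde2007, Ch. 5 §5.1 Thm. 5.1 (proof, after (13))] -/
theorem ishikawaIter_exists_fixedPoint_subseq_tendsto (hKc : IsCompact K)
    (h2 : ∀ ⦃x⦄, x ∈ K → ∀ ⦃y⦄, y ∈ K → ‖T x - T y‖ ^ 2 ≤ ‖x - y‖ ^ 2 + ‖(x - T x) - (y - T y)‖ ^ 2)
    (h3 : ∀ ⦃x⦄, x ∈ K → ∀ ⦃y⦄, y ∈ K → ‖T x - T y‖ ≤ L * ‖x - y‖)
    (hK : Convex ℝ K) (hTK : MapsTo T K K) (hx₀ : x₀ ∈ K) (hfix : ∃ p ∈ K, T p = p)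
    (hα0 : ∀ n, 0 ≤ α n) (hαβ : ∀ n, α n ≤ β n) (hβ1 : ∀ n, β n ≤ 1)
    (hβ : Tendsto β atTop (𝓝 0))
    (hdiv : Tendsto (fun n => ∑ k ∈ range n, α k * β k) atTop atTop) :
    ∃ q ∈ K, T q = q ∧ ∃ φ : ℕ → ℕ, StrictMono φ ∧
      Tendsto (fun j => ishikawaIter T α β x₀ (φ j)) atTop (𝓝 q) := by
  set x := ishikawaIter T α β x₀ with hx_def
  have hxK : ∀ n, x n ∈ K := ishikawaIter_mem hK hTK hx₀ hα0 hαβ hβ1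
  -- a subsequence with residual `< 1/(k+1)`
  have hfreq : ∀ k : ℕ, ∃ᶠ n in atTop, ‖x n - T (x n)‖ < 1 / ((k : ℝ) + 1) := fun k =>
    ishikawaIter_frequently_residual_lt h2 h3 hK hTK hx₀ hfix hα0 hαβ hβ1 hβ hdiv (by positivity)
  obtain ⟨φ, hφ, hφres⟩ := extraction_forall_of_frequently hfreq
  -- a further subsequence converging in the compact set `K`
  obtain ⟨q, hqK, ψ, hψ, hlim⟩ := hKc.tendsto_subseq (x := x ∘ φ) fun n => hxK (φ n)
  refine ⟨q, hqK, ?_, φ ∘ ψ, hφ.comp hψ, hlim⟩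
  -- along `φ ∘ ψ`: `x → q`, `Tx → Tq` (continuity on `K`) and `x - Tx → 0`; so `q - Tq = 0`
  have hres0 : Tendsto (fun j => ‖(x ∘ φ) (ψ j) - T ((x ∘ φ) (ψ j))‖) atTop (𝓝 0) := by
    have hup : ∀ j, ‖(x ∘ φ) (ψ j) - T ((x ∘ φ) (ψ j))‖ ≤ 1 / ((j : ℝ) + 1) := fun j => by
      refine (hφres (ψ j)).le.trans ?_
      gcongr
      exact_mod_cast hψ.id_le j
    exact squeeze_zero (fun j => norm_nonneg _) hup tendsto_one_div_add_atTop_nhds_zero_nat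
  have hT : Tendsto (fun j => T ((x ∘ φ) (ψ j))) atTop (𝓝 (T q)) := by
    have hL0 : ∀ j, ‖T ((x ∘ φ) (ψ j)) - T q‖ ≤ |L| * ‖(x ∘ φ) (ψ j) - q‖ := fun j =>
      (h3 (hxK _) hqK).trans (mul_le_mul_of_nonneg_right (le_abs_self L) (norm_nonneg _))
    have h0 : Tendsto (fun j => |L| * ‖(x ∘ φ) (ψ j) - q‖) atTop (𝓝 0) := by
      have h1 := (tendsto_iff_norm_sub_tendsto_zero.1 hlim).const_mul |L|
      rwa [mul_zero] at h1
    exact tendsto_iff_norm_sub_tendsto_zero.2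
      (squeeze_zero (fun j => norm_nonneg _) hL0 h0)
  have hdiff : Tendsto (fun j => (x ∘ φ) (ψ j) - T ((x ∘ φ) (ψ j))) atTop (𝓝 (q - T q)) :=
    hlim.sub hT
  have hdiff0 : Tendsto (fun j => (x ∘ φ) (ψ j) - T ((x ∘ φ) (ψ j))) atTop (𝓝 0) :=
    tendsto_zero_iff_norm_tendsto_zero.2 hres0
  have e := tendsto_nhds_unique hdiff hdiff0
  exact (sub_eq_zero.1 e).symm

/-- **Theorem 5.1** (Ishikawa 1974): `K` convex compact, `T(K) ⊆ K`, `T` Lipschitzian and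
pseudocontractive on `K` with a fixed point in `K`, `0 ≤ α_n ≤ β_n ≤ 1`, `β_n → 0`,
`Σ α_nβ_n = ∞`.  Then for every `x₀ ∈ K` the Ishikawa iteration converges (strongly) to a fixed
point of `T`.
[cite: Berinde2007, Ch. 5 §5.1 Thm. 5.1] -/
theorem exists_fixedPoint_tendsto_ishikawaIter (hKc : IsCompact K) (hK : Convex ℝ K)
    (hTK : MapsTo T K K)
    (h2 : ∀ ⦃x⦄, x ∈ K → ∀ ⦃y⦄, y ∈ K → ‖T x - T y‖ ^ 2 ≤ ‖x - y‖ ^ 2 + ‖(x - T x) - (y - T y)‖ ^ 2)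
    (h3 : ∀ ⦃x⦄, x ∈ K → ∀ ⦃y⦄, y ∈ K → ‖T x - T y‖ ≤ L * ‖x - y‖)
    (hfix : ∃ p ∈ K, T p = p)
    (hα0 : ∀ n, 0 ≤ α n) (hαβ : ∀ n, α n ≤ β n) (hβ1 : ∀ n, β n ≤ 1)
    (hβ : Tendsto β atTop (𝓝 0))
    (hdiv : Tendsto (fun n => ∑ k ∈ range n, α k * β k) atTop atTop) (hx₀ : x₀ ∈ K) :
    ∃ q ∈ K, T q = q ∧ Tendsto (ishikawaIter T α β x₀) atTop (𝓝 q) := by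
  obtain ⟨q, hqK, hTq, φ, hφ, hlim⟩ := ishikawaIter_exists_fixedPoint_subseq_tendsto hKc h2 h3 hK
    hTK hx₀ hfix hα0 hαβ hβ1 hβ hdiv
  obtain ⟨N, hN⟩ := exists_forall_ishikawaCoeff_le_half hβ L
  refine ⟨q, hqK, hTq, ?_⟩
  rw [tendsto_iff_norm_sub_tendsto_zero]
  have hlim0 := tendsto_iff_norm_sub_tendsto_zero.1 hlim
  refine Metric.tendsto_atTop.2 fun ε hε => ?_
  -- pick `j` with `φ j ≥ N` and `‖x_{φ j} - q‖ < ε`; then `‖x_n - q‖ < ε` for all `n ≥ φ j`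
  obtain ⟨j₀, hj₀⟩ := Metric.tendsto_atTop.1 hlim0 ε hε
  set j := max j₀ N with hj
  have hφj : N ≤ φ j := (le_max_right j₀ N).trans (hφ.id_le j)
  refine ⟨φ j, fun n hn => ?_⟩
  have h1 := hj₀ j (le_max_left _ _)
  rw [Real.dist_eq, sub_zero, abs_of_nonneg (norm_nonneg _)] at h1 ⊢
  exact (norm_ishikawaIter_sub_le_of_le h2 h3 hK hTK hx₀ hqK hTq hα0 hαβ hβ1 hN hφj hn).trans_lt
    h1

end Theorem51

end Literature.Analysis.Convex.IshikawaIteration
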